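import Summits.Ventures.PercRepro.S1ChainCoNullCellsTP
import Summits.Ventures.PercRepro.S1CellNineThirteen
import Summits.Ventures.PercRepro.S1SeriesLever

/-!
# PercRepro — THE CELL `(9, 10)` MODULO THE HIGH-`t` CAP (p2, gen 26; SUBCLAIM-S1 §6.10)

The first cell of row `9`. The coloop cases `c = 1, 2` close on the landed conull consumer at the lever caps
(`173 / 1401` on `18` points, `180 / 1433` on `17`; worst margins `+103,808` and `+177,189`), `c ≥ 3` is lossy
(`Φ(9, 4) = 8.4 ≤ 14`). The coloop-free case closes on the PRUNED consumer (`S1ChainCoNullCellsTP`) at the lever cap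
`167` for `t ≤ 13` (worst margin `+977` at `t = 10`; the unpruned consumer failed at `t = 6 … 11` on the vacuous
`(B, 1, 3)`-lines) and needs, at `t ≥ 14`, the four-circuit cap `164 − 8 (t − 14)` — `164 / 156 / 148 / 140 / 132 / 124`
at `t = 14 … 19` (exact twin mining/p2/g26/caps910c.py; `165` at `t = 14` fails). That cap is the one hypothesis:

* `gb_cap_ten` — the series-class cap at nullity `10`; `capNineTenT`, `rrNineTen` — the cap table and chain lengths;
* **`c025_core_nine_ten_of_cap`** — `RLS` at `(9, 4)` on every `e`-free core of rank `9` with `19` points, provided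
  (P9,10): «every coloop-free `e`-free matroid of nullity `10` with `19` points and `t ≥ 14` triangles has at most
  `164 − 8 (t − 14)` four-circuits».
Axioms: standard.
-/

open scoped Matroid

namespace PercRepro

namespace S1

open Set

variable {α : Type}

/-- **The series-class cap at nullity `10`**: `s₄ ≤ gb 10 n` on the coloop-free part. -/
theorem gb_cap_ten (p n S : ℕ) (hn : n = p + 10) (hv : gb 10 n = S) : ∀ (N : Matroid α) [N.Finite],
    (∀ e ∈ N.E, ∃ A ⊆ N.E \ {e}, e ∉ N.closure A ∧ e ∉ N.closure ((N.E \ {e}) \ A)) →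
    N.E.encard = N.eRank + ((10 : ℕ) : ℕ∞) → N.E.ncard = p + 10 → N.coloops = ∅ →
    {C : Set α | N.IsCircuit C ∧ C.ncard = 4}.ncard ≤ S := by
  intro N _ hfree hd hn' hcol
  have h := ncard_fourCircuits_le_gb_of_coloopFree N hfree hd hcol hn'
  rwa [← hn, hv] at h

/-- The four-circuit cap of the coloop-free lines of `(9, 10)` at triangle count `t`: the lever cap `167` for
`t ≤ 13`, then `164 − 8 (t − 14)` (`164, 156, 148, 140, 132, 124` at `t = 14 … 19`). -/
def capNineTenT (t : ℕ) : ℕ := if t ≤ 13 then 167 else 164 - 8 * (t - 14)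

/-- The chain length `r` at each `t = s₃` (every coloop case): the largest admissible `r` up to `8`
(`cq3 (r − 1) < t`, `cq3` monotone below `r`). -/
def rrNineTen (t : ℕ) : ℕ := [0, 1, 2, 3, 3, 4, 5, 5, 6, 6, 6, 7, 8, 8, 8, 8, 8, 8, 8, 8].getD t 0

/-- **THE CELL `(9, 10)` MODULO THE HIGH-`t` CAP**: `RLS` at `(9, 4)` on every `e`-free core of rank `9` with `19`
points, provided every coloop-free `e`-free matroid of nullity `10` with `19` points and `t ≥ 14` triangles has at
most `164 − 8 (t − 14)` four-circuits. -/
theorem c025_core_nine_ten_of_cap (M : Matroid α) [M.Finite] (hR : M.eRank = (9 : ℕ)) (hn : M.E.ncard = 19)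
    (hfree : ∀ e ∈ M.E, ∃ A ⊆ M.E \ {e}, e ∉ M.closure A ∧ e ∉ M.closure ((M.E \ {e}) \ A))
    (hcap : ∀ (N : Matroid α) [N.Finite],
      (∀ e ∈ N.E, ∃ A ⊆ N.E \ {e}, e ∉ N.closure A ∧ e ∉ N.closure ((N.E \ {e}) \ A)) →
      N.E.encard = N.eRank + ((10 : ℕ) : ℕ∞) → N.E.ncard = 19 → N.coloops = ∅ →
      ∀ t, 14 ≤ t → {C : Set α | N.IsCircuit C ∧ C.ncard = 3}.ncard = t →
      {C : Set α | N.IsCircuit C ∧ C.ncard = 4}.ncard ≤ 164 - 8 * (t - 14)) :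
    ThmN.RLS M 9 4 := by
  rcases (show M.coloops.ncard = 0 ∨ M.coloops.ncard = 1 ∨ M.coloops.ncard = 2 ∨ 3 ≤ M.coloops.ncard by omega)
    with h | h | h | h
  · refine rls_of_ladder_case_chain_conull_capTP M (p := 9) (c := 0) (d := 10) (by norm_num) (by norm_num) hR hn hfree h
      (by norm_num) (by norm_num) (P := 19) (S5 := 1373) capNineTenT (by decide) ?_
      (by decide) rrNineTen (by decide) (by decide +kernel) (by decide +kernel) (by decide +kernel)
    intro N _ hNfree hNd hNn hNcol t ht
    unfold capNineTenT
    split_ifs with h13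
    · exact gb_cap_ten 9 19 167 rfl (by decide) N hNfree hNd hNn hNcol
    · exact hcap N hNfree hNd hNn hNcol t (by omega) ht
  · exact rls_of_ladder_case_chain_conull M (p := 8) (c := 1) (d := 10) (by norm_num) (by norm_num) hR hn hfree h
      (by norm_num) (by norm_num) (P := 19) (S := 173) (S5 := 1401) (by decide) (gb_cap_ten 8 18 173 rfl (by decide))
      (by decide) rrNineTen (by decide) (by decide +kernel) (by decide +kernel) (by decide +kernel)
  · exact rls_of_ladder_case_chain_conull M (p := 7) (c := 2) (d := 10) (by norm_num) (by norm_num) hR hn hfree h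
      (by norm_num) (by norm_num) (P := 19) (S := 180) (S5 := 1433) (by decide) (gb_cap_ten 7 17 180 rfl (by decide))
      (by decide) rrNineTen (by decide) (by decide +kernel) (by decide +kernel) (by decide +kernel)
  · exact rls_of_coloops_lossy M (p := 6) (c := 3) (hR.trans (by norm_num)) (by norm_num) h phiK_nine_four_le

end S1

end PercRepro
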